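import Summits.ResolutionOfSingularities.ResolutionOfSingularities.Theorems.WeightedInvariantIota3Sigma
import Literature.AlgebraicGeometry.Resolution.CharPolyhedronMinimalIsMinimum
import Mathlib.RingTheory.PowerSeries.Inverse
import HarnessLib

/-!
# R10b FLAG–δ BRIDGE, DEFINITIONS (PART 1 of 2): coefficientwise ideals of `S₀⟦X⟧` (`coeffIdeal`, `mPowCoeff`), the dictionary weights
# `bridgeWeights = (q/r₁, r₂/r₁)` / `frameWeights = (q, r₂, r₁)`, and the rev-2 candidate Prop `FlagDeltaBridge` (PROVED in PART 2)

**Provenance / honest framing.** VERBATIM PORT (proofs and statements unchanged; namespace `…LocalEngine.Iota3` instead of the sketch's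
`…Iota3.JCanCensus`) of res-L1-w43-idea-2's kernel-checked Sketch-R10b rev 3 (`L/res-L1-w43-idea-2/Sketch-R10b.lean` 49910a960c44be17 = Bridge.lean
5cf5befd4aeabefc + Bridge2.lean 33f24935844a1560; farm rc 0 · 0 sorries per the dealer), dealt by res-L1-w43-plan-1 (STATUS 2026-08-27T21:18:33Z, «KEY
residue tooling», door item `stmt-ResolutionOfSingularities-19897`, consumer res-D-brk-1 for the (o70-b) residue), ported by res-L1-type-o4;
`--supports stmt-ResolutionOfSingularities-19897 --as helper`. [OURS · L1 w43 · idea-2 R10b] Everything here is OURS elementary commutative algebra over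
Mathlib, the tree's `flagContactFiltration` / `AdmissibleTriple` (…Iota3Sigma) and the LANDED Cossart–Piltant calculus
(`Literature/AlgebraicGeometry/Resolution/CharPolyhedronMinimalIsMinimum.lean`: `monomialIdeal`, `weight`, `DeltaGE`, `IsMinimal`, Hironaka 1967 Thm. (4.8)
= Cossart–Piltant 2019 Prop. 2.2 (2), PROVED there); every `def` is an OURS bookkeeping notion of the sketch — NOT a statement of H. Hironaka's 2017
manuscript (under adjudication; nothing of it is asserted or used); no Literature fact is introduced; AI-written and AI-ported, weaker than expert review;
nothing here is progress on resolution of singularities in positive characteristic.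

PART 2 = `WeightedInvariantIota3FlagDeltaBridge` (def-free): Hironaka (4.8) as DOMINANCE OF TRANSLATES (`IsMinimal.mem_monomialIdeal_of_deltaGE_taylor`),
the bridge `coe_mem_flagContactFiltration_iff_deltaGE` / `flagDeltaBridge_holds`, and `flagContactFiltration_eq_monomialIdeal` (res-D-brk-1's intrinsic
two-flag filtration IS Cossart–Piltant's three-parameter monomial ideal in ANY local `S`).
-/

noncomputable section

open Polynomial IsLocalRing
open Literature.AlgebraicGeometry.Resolution.CossartPiltant
open Summit.ResolutionOfSingularities.ResolutionOfSingularities.Theorems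

set_option linter.dupNamespace false

namespace Summit.ResolutionOfSingularities.ResolutionOfSingularities.Cruxes.HypersurfaceCentreConstruction.LocalEngine.Iota3

/-! ### §3a (defs) Coefficientwise ideals of `S₀⟦X⟧` -/

section CoeffIdeal

variable {S₀ : Type*} [CommRing S₀]

/-- The ideal of power series whose `j`-th coefficient lies in `I j`, for a MONOTONE family `I` (so that it is an ideal).
[OURS · R10b §3a · bookkeeping] -/
def coeffIdeal (I : ℕ → Ideal S₀) (hI : Monotone I) : Ideal (PowerSeries S₀) where
  carrier := {f | ∀ j, PowerSeries.coeff j f ∈ I j}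
  add_mem' := by
    intro f g hf hg j
    simp only [map_add]
    exact (I j).add_mem (hf j) (hg j)
  zero_mem' := by
    intro j
    simp
  smul_mem' := by
    intro c f hf j
    simp only [smul_eq_mul, PowerSeries.coeff_mul]
    refine (I j).sum_mem fun p hp => ?_
    have hp2 : p.2 ≤ j := by
      have := Finset.HasAntidiagonal.mem_antidiagonal.mp hp
      omega
    exact (I j).mul_mem_left _ (hI hp2 (hf p.2))

/-- Membership in `coeffIdeal I hI` is coefficientwise membership. [OURS · R10b §3a · bookkeeping] -/
theorem mem_coeffIdeal {I : ℕ → Ideal S₀} {hI : Monotone I} {f : PowerSeries S₀} :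
    f ∈ coeffIdeal I hI ↔ ∀ j, PowerSeries.coeff j f ∈ I j := Iff.rfl

variable [IsLocalRing S₀]

/-- The coefficient profile of `𝔪^e`: `coeff_j ∈ 𝔪₀^(e - j)`. -/
def mPowCoeff (S₀ : Type*) [CommRing S₀] [IsLocalRing S₀] (e : ℕ) : ℕ → Ideal S₀ := fun j => maximalIdeal S₀ ^ (e - j)

/-- `mPowCoeff S₀ e` is monotone in the coefficient index. [OURS · R10b §3a · bookkeeping] -/
theorem mPowCoeff_mono (e : ℕ) : Monotone (mPowCoeff S₀ e) :=
  fun a b hab => Ideal.pow_le_pow_right (by omega)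

end CoeffIdeal

/-! ### §3c (defs) The dictionary weights `α = (q/r₁, r₂/r₁)` and the rev-2 candidate `FlagDeltaBridge` -/

section Bridge

variable {S₀ : Type*} [CommRing S₀] [IsLocalRing S₀]

/-- The weights `α = (q/r₁, r₂/r₁)` of the dictionary. -/
noncomputable def bridgeWeights (q r₁ r₂ : ℕ) : Fin 2 → ℝ := fun i => if i = 0 then (q : ℝ) / r₁ else (r₂ : ℝ) / r₁

/-- `bridgeWeights q r₁ r₂ 0 = q/r₁`. [OURS · R10b §3c · bookkeeping] -/
@[simp] theorem bridgeWeights_zero (q r₁ r₂ : ℕ) : bridgeWeights q r₁ r₂ 0 = (q : ℝ) / r₁ := by simp [bridgeWeights]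
/-- `bridgeWeights q r₁ r₂ 1 = r₂/r₁`. [OURS · R10b §3c · bookkeeping] -/
@[simp] theorem bridgeWeights_one (q r₁ r₂ : ℕ) : bridgeWeights q r₁ r₂ 1 = (r₂ : ℝ) / r₁ := by simp [bridgeWeights]

/-- The `bridgeWeights`-weight of an exponent pair. [OURS · R10b §3c · bookkeeping] -/
theorem weight_bridgeWeights (q r₁ r₂ : ℕ) (x : Fin 2 → ℕ) :
    weight (bridgeWeights q r₁ r₂) x = (q : ℝ) / r₁ * x 0 + (r₂ : ℝ) / r₁ * x 1 := by
  simp [weight, Fin.sum_univ_two]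

/-- The rev-2 CANDIDATE, verbatim. -/
def FlagDeltaBridge (S₀ : Type) [CommRing S₀] [IsLocalRing S₀] : Prop :=
  ∀ (u : Fin 2 → S₀) (h : S₀[X]) (q r₁ r₂ : ℕ), h.Monic → AdmissibleTriple q r₁ r₂ →
    maximalIdeal S₀ = Ideal.span (Set.range u) →
    (∀ (i : Fin 2) (T : Finset (Fin 2)), i ∉ T → ∀ y, u i * y ∈ Ideal.span (u '' ↑T) → y ∈ Ideal.span (u '' ↑T)) →
    ((h : PowerSeries S₀) ∈ flagContactFiltration (PowerSeries.X : PowerSeries S₀) (PowerSeries.C (u 1)) q r₁ r₂ (r₁ * h.natDegree)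
      ↔ DeltaGE u (fun i => if i = 0 then (q : ℝ) / r₁ else (r₂ : ℝ) / r₁) h 1)

end Bridge

/-! ### §3d (defs) The weights `(q, r₂, r₁)` on the frame `u = (x, g₂, g₁)` -/

section Intrinsic

/-- The weights `(q, r₂, r₁)` on the frame `u = (x, g₂, g₁)`. -/
noncomputable def frameWeights (q r₁ r₂ : ℕ) : Fin 3 → ℝ :=
  fun i => if i = 0 then (q : ℝ) else if i = 1 then (r₂ : ℝ) else (r₁ : ℝ)

/-- `frameWeights q r₁ r₂ 0 = q`. [OURS · R10b §3d · bookkeeping] -/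
@[simp] theorem frameWeights_zero (q r₁ r₂ : ℕ) : frameWeights q r₁ r₂ 0 = q := by simp [frameWeights]
/-- `frameWeights q r₁ r₂ 1 = r₂`. [OURS · R10b §3d · bookkeeping] -/
@[simp] theorem frameWeights_one (q r₁ r₂ : ℕ) : frameWeights q r₁ r₂ 1 = r₂ := by simp [frameWeights]
/-- `frameWeights q r₁ r₂ 2 = r₁`. [OURS · R10b §3d · bookkeeping] -/
@[simp] theorem frameWeights_two (q r₁ r₂ : ℕ) : frameWeights q r₁ r₂ 2 = r₁ := by
  simp [frameWeights, show (2 : Fin 3) ≠ 0 from by decide, show (2 : Fin 3) ≠ 1 from by decide]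

/-- The `frameWeights`-weight of an exponent triple. [OURS · R10b §3d · bookkeeping] -/
theorem weight_frameWeights (q r₁ r₂ : ℕ) (x : Fin 3 → ℕ) :
    weight (frameWeights q r₁ r₂) x = (q : ℝ) * x 0 + (r₂ : ℝ) * x 1 + (r₁ : ℝ) * x 2 := by
  simp [weight, Fin.sum_univ_three]

end Intrinsic

end Summit.ResolutionOfSingularities.ResolutionOfSingularities.Cruxes.HypersurfaceCentreConstruction.LocalEngine.Iota3
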